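import Literature.AlgebraicGeometry.Resolution.AlterationsSplitNodalDischarges
import Literature.AlgebraicGeometry.Resolution.AlterationsSingularComponentsProofs
import HarnessLib

/-!
# `WildQuotients.SummitReduction` (stmt-ResolutionOfSingularities-16324), line `FramePerfect`, skeleton v8:
# stub `stub_pair_quasiSplitNormalForm` (N) — helper file 7: "`nᵢ ∈ {0, 1}`" from `codim(Sing X, X) ≥ 3`
# over any field, and the trace `{i | f^#(tᵢ) ∈ P}` of a minimal non-regular prime (de Jong 1996, 3.5)

Route `ResolutionOfSingularities/WildQuotients`, crux `SummitReduction`; sub-goals of the registered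
stub `stub_pair_quasiSplitNormalForm` of the line skeleton `Cruxes/SummitReduction/Lines/FramePerfect.lean`
(v8, lead c4). Worker file; only tree inputs.

De Jong 1996, 3.5 (p. 64): "Looking at the equations `Q - t₁^{n₁} ⋯ t_r^{n_r}` for a point
`x ∈ Sing(X)` as in 3.3, we see that we must have `nᵢ ∈ {0, 1}`. … (In the equations above `X` is
singular along `u = v = tᵢ = tⱼ = 0`.)" The tree proves the first sentence
(`DeJong1996CodimThreeExponentsLeOne.of_polynomial`) inside a named fact quantified over
algebraically closed fields, though its proof uses none of that; and its analysis of the primes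
`(u, v, T_a, T_b)` (`core_map_eq`, `AlterationsSingularComponentsProofs.lean`) is general. Here:

* `exponent_le_one_of_codimThree` — "`nᵢ ∈ {0, 1}`" for a presentation
  `𝒪̂_{X,x} ≅ K⟦u, v, t⟧/(uv - ∏ tⱼ^{nnⱼ})` over ANY coefficient field `K` and any ground field
  (a presentation with `nnᵢ ≥ 2` has the non-regular prime `(u, v, tᵢ)` of height `2`, which
  descends to a non-regular point of `X` of codimension `≤ 2` along the G-ring `𝒪_{X,x}`, Mizutani's
  `Matsumura1987_32_polynomial_holds`);
* `mem_iff_of_map_eq_comap_singPrime` — `τᵢ ∈ P` iff `i ∈ {a, b}` when `P 𝒪̂ = e⁻¹(u, v, T_a, T_b)`;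
* `eq_of_minimal_of_forall_mem_iff` — two minimal non-regular primes of a local G-ring `R` with
  `R̂ ≅ K⟦u, v, T⟧/(uv - ∏ Tᵢ^{νᵢ})`, `νᵢ ≤ 1`, having the same trace `{i | τᵢ ∈ P}` (at the indices
  with `νᵢ ≠ 0`) coincide — the germ form of de Jong 1997, 5.11 ¶2 "`⋃ g(E_α)` is a disjoint union
  of components", used by the orbit field.
-/

set_option linter.dupNamespace false

noncomputable section

open CategoryTheory CategoryTheory.Limits AlgebraicGeometry TopologicalSpace Topology
open Literature.AlgebraicGeometry.Resolution
open Literature.AlgebraicGeometry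
open IsLocalRing Scheme.IdealSheafData DeJong1996 DeJong1996.FormalNodeRing

namespace Summit.ResolutionOfSingularities.ResolutionOfSingularities.Theorems

universe u

/-! ## `nᵢ ∈ {0, 1}` -/

section Local

variable {k : Type u} [Field k] {X Y : Scheme.{u}} {f : X ⟶ Y} {g : Y ⟶ Spec (.of k)}
  {D : Set Y} {n : ℕ} {τ : Fin n → (Y ⟶ X)}

/-- **de Jong 1996, 3.5, first sentence, over any field: `codim(Sing(X), X) ≥ 3` forces
`nᵢ ∈ {0, 1}`.** If some exponent `nnᵢ ≥ 2` in a presentation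
`𝒪̂_{X,x} ≅ K⟦u, v, t⟧/(uv - ∏ⱼ tⱼ^{nnⱼ})`, the prime `(u, v, tᵢ)` of the formal model gives a
non-regular local ring of dimension `≤ 2` of the completion, hence (formal fibres of the G-ring
`𝒪_{X,x}` being regular, `isGRing_stalk_of_polynomial` with Mizutani's
`Matsumura1987_32_polynomial_holds`, and heights not increasing under contraction) a non-regular
point `x'` of `X` with `dim 𝒪_{X,x'} ≤ 2`, contradicting `codim(Sing(X), X) ≥ 3`. The tree's
`DeJong1996CodimThreeExponentsLeOne.of_polynomial` without algebraic closedness.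
[cite: DeJong1996, 3.5, p. 64] -/
theorem exponent_le_one_of_codimThree (hS : DeJong1996.SemiStablePair f g D τ)
    (hcodim : ∀ x : X, ¬ IsRegularLocalRing (X.presheaf.stalk x) →
      (3 : WithBot ℕ∞) ≤ ringKrullDim (X.presheaf.stalk x))
    {K : Type u} [Field K] {m : ℕ} {nn : Fin m → ℕ} {x : X}
    (e : AdicCompletion (maximalIdeal (X.presheaf.stalk x)) (X.presheaf.stalk x) ≃+*
      DeJong1996.NodalPowRing K m nn) (i : Fin m) : nn i ≤ 1 := by
  by_contra hni
  have hi : 2 ≤ nn i := by omega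
  -- the singular prime of the formal model
  obtain ⟨𝔓, h𝔓, hnreg, hdim⟩ :=
    DeJong1996.exists_prime_nodalPowRing_not_isRegularLocalRing (k := K) nn i hi
  haveI := hS.isIntegral
  haveI : IsNoetherian X := DeJong1996.isNoetherian_of_isProjectiveOver (f ≫ g) hS.isProjectiveOver
  haveI : LocallyOfFiniteType (f ≫ g) := hS.locallyOfFiniteType
  -- transport `𝔓` to the completion `𝒪̂_{X,x}` along `e`
  let 𝔓' : Ideal (AdicCompletion (maximalIdeal (X.presheaf.stalk x)) (X.presheaf.stalk x)) :=
    𝔓.comap e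
  haveI h𝔓' : 𝔓'.IsPrime := Ideal.comap_isPrime e 𝔓
  let eloc : Localization.AtPrime 𝔓' ≃+* Localization.AtPrime 𝔓 :=
    IsLocalization.ringEquivOfRingEquiv (Localization.AtPrime 𝔓') (Localization.AtPrime 𝔓) e
      (e.map_primeCompl_comap_eq 𝔓)
  have hnreg' : ¬ IsRegularLocalRing (Localization.AtPrime 𝔓') := fun h =>
    hnreg (IsRegularLocalRing.of_ringEquiv eloc)
  have hdim' : ringKrullDim (Localization.AtPrime 𝔓') ≤ 2 := by
    rw [ringKrullDim_eq_of_ringEquiv eloc]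
    exact hdim
  -- `𝒪_{X,x}` is a G-ring, so regularity and dimension pass to the contraction `𝔭`
  have hGA : IsGRing (X.presheaf.stalk x) :=
    isGRing_stalk_of_polynomial Matsumura1987_32_polynomial_holds (f ≫ g) x
  obtain ⟨hiff, hle⟩ := hGA.isRegularLocalRing_localization_adicCompletion_iff 𝔓'
  have h1 : ¬ IsRegularLocalRing
      (Localization.AtPrime (𝔓'.under (X.presheaf.stalk x))) := fun h => hnreg' (hiff.mpr h)
  have h2 : ringKrullDim (Localization.AtPrime (𝔓'.under (X.presheaf.stalk x))) ≤ 2 :=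
    hle.trans hdim'
  -- the point `x'` of `X` whose local ring is `(𝒪_{X,x})_𝔭`
  obtain ⟨x', -, ⟨e2⟩⟩ :=
    exists_specializes_ringEquiv_localization x (𝔓'.under (X.presheaf.stalk x))
  have hx'nreg : ¬ IsRegularLocalRing (X.presheaf.stalk x') := fun h =>
    h1 (IsRegularLocalRing.of_ringEquiv e2)
  have h3 := hcodim _ hx'nreg
  rw [ringKrullDim_eq_of_ringEquiv e2] at h3
  have h32 : (3 : WithBot ℕ∞) ≤ 2 := h3.trans h2
  exact absurd h32 (by decide)

end Local

/-! ## The trace of `(u, v, T_a, T_b)` on `R` -/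

/-- **`τᵢ ∈ P` iff `i ∈ {a, b}`** when `P R̂ = e⁻¹(u, v, T_a, T_b)` for a Noetherian local ring `R`
with `e : R̂ ≅ K⟦u, v, T⟧/(uv - ∏ Tᵢ^{νᵢ})`, `e(τᵢ) = Tᵢ` (`R̂` is faithfully flat over `R`, and
`T_c ∈ (u, v, T_a, T_b)` iff `c ∈ {a, b}`, `mk_X_inr_mem_singPrime_iff`). [cite: DeJong1996, 3.5, p. 64] -/
theorem mem_iff_of_map_eq_comap_singPrime {K : Type u} [Field K] {m : ℕ} {ν : Fin m → ℕ}
    {R : Type u} [CommRing R] [IsLocalRing R] [IsNoetherianRing R]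
    (e : AdicCompletion (maximalIdeal R) R ≃+* FormalNodeRing K m ν) (τ : Fin m → R)
    (hτ : ∀ i, e (algebraMap R _ (τ i)) = Ideal.Quotient.mk _ (MvPowerSeries.X (Sum.inr i)))
    {P : Ideal R} {a b : Fin m} (hab : a ≠ b) (ha : ν a ≠ 0) (hb : ν b ≠ 0)
    (hPJ : P.map (algebraMap R (AdicCompletion (maximalIdeal R) R)) =
      (singPrime K m ν a b).comap e.toRingHom) (i : Fin m) :
    τ i ∈ P ↔ i = a ∨ i = b := by
  haveI : Module.FaithfullyFlat R (AdicCompletion (maximalIdeal R) R) :=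
    Module.FaithfullyFlat.of_flat_of_isLocalHom
  have h1 : τ i ∈ P ↔ algebraMap R (AdicCompletion (maximalIdeal R) R) (τ i) ∈
      P.map (algebraMap R (AdicCompletion (maximalIdeal R) R)) := by
    constructor
    · exact Ideal.mem_map_of_mem _
    · intro hmem
      have h2 : τ i ∈ (P.map (algebraMap R (AdicCompletion (maximalIdeal R) R))).comap
          (algebraMap R (AdicCompletion (maximalIdeal R) R)) := Ideal.mem_comap.mpr hmem
      rwa [Ideal.comap_map_eq_self_of_faithfullyFlat] at h2
  rw [h1, hPJ, Ideal.mem_comap, RingEquiv.toRingHom_eq_coe, RingHom.coe_coe, hτ i,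
    mk_X_inr_mem_singPrime_iff K hab ha hb i]

/-- **Two minimal non-regular primes with the same trace coincide.** In the situation of
`core_map_eq` (`R` a Noetherian local G-ring, `e : R̂ ≅ K⟦u, v, T⟧/(uv - ∏ Tᵢ^{νᵢ})`, all
`νᵢ ≤ 1`, `e(τᵢ) = Tᵢ`), two primes `P, P'` of `R` which are minimal non-regular (non-regular
localisation, and no smaller non-regular prime) and satisfy `τᵢ ∈ P ↔ τᵢ ∈ P'` for all `i` are
equal (the trace condition being needed only at the indices with `νᵢ ≠ 0`): `P R̂ = e⁻¹(u, v, T_a, T_b)`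
and `P' R̂ = e⁻¹(u, v, T_{a'}, T_{b'})` with `{a, b} = {i | τᵢ ∈ P} = {i | τᵢ ∈ P'} = {a', b'}`
among such indices, and `R̂` is faithfully flat over `R`.
[cite: DeJong1996, 3.5, p. 64] -/
theorem eq_of_minimal_of_forall_mem_iff {K : Type u} [Field K] {m : ℕ} {ν : Fin m → ℕ}
    {R : Type u} [CommRing R] [IsLocalRing R] (hG : IsGRing R) (hν1 : ∀ i, ν i ≤ 1)
    (e : AdicCompletion (maximalIdeal R) R ≃+* FormalNodeRing K m ν) (τ : Fin m → R)
    (hτ : ∀ i, e (algebraMap R _ (τ i)) = Ideal.Quotient.mk _ (MvPowerSeries.X (Sum.inr i)))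
    (P P' : Ideal R) [P.IsPrime] [P'.IsPrime]
    (hPreg : ¬ IsRegularLocalRing (Localization.AtPrime P))
    (hPmin : ∀ (q : Ideal R) (hq : q.IsPrime), q ≤ P →
      ¬ IsRegularLocalRing (@Localization.AtPrime _ _ q hq) → q = P)
    (hP'reg : ¬ IsRegularLocalRing (Localization.AtPrime P'))
    (hP'min : ∀ (q : Ideal R) (hq : q.IsPrime), q ≤ P' →
      ¬ IsRegularLocalRing (@Localization.AtPrime _ _ q hq) → q = P')
    (hiff : ∀ i, ν i ≠ 0 → (τ i ∈ P ↔ τ i ∈ P')) : P = P' := by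
  haveI : IsNoetherianRing R := hG.1
  haveI : Module.FaithfullyFlat R (AdicCompletion (maximalIdeal R) R) :=
    Module.FaithfullyFlat.of_flat_of_isLocalHom
  obtain ⟨a, b, hab, ha, hb, hta, htb, hPJ⟩ := core_map_eq hG hν1 e τ hτ P hPreg hPmin
  obtain ⟨a', b', hab', ha', hb', hta', htb', hP'J⟩ := core_map_eq hG hν1 e τ hτ P' hP'reg hP'min
  have ha0 : ν a ≠ 0 := by rw [ha]; exact one_ne_zero
  have hb0 : ν b ≠ 0 := by rw [hb]; exact one_ne_zero
  have ha'0 : ν a' ≠ 0 := by rw [ha']; exact one_ne_zero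
  have hb'0 : ν b' ≠ 0 := by rw [hb']; exact one_ne_zero
  -- `{a, b} ⊆ {a', b'}`
  have hin : ∀ c, c = a ∨ c = b → c = a' ∨ c = b' := by
    intro c hc
    have hc0 : ν c ≠ 0 := by
      rcases hc with rfl | rfl
      · exact ha0
      · exact hb0
    have h1 : τ c ∈ P := (mem_iff_of_map_eq_comap_singPrime e τ hτ hab ha0 hb0 hPJ c).mpr hc
    exact (mem_iff_of_map_eq_comap_singPrime e τ hτ hab' ha'0 hb'0 hP'J c).mp ((hiff c hc0).mp h1)
  have hJ : P.map (algebraMap R (AdicCompletion (maximalIdeal R) R)) =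
      P'.map (algebraMap R (AdicCompletion (maximalIdeal R) R)) := by
    rw [hPJ, hP'J]
    rcases hin a (Or.inl rfl) with rfl | rfl
    · rcases hin b (Or.inr rfl) with h | rfl
      · exact absurd h hab.symm
      · rfl
    · rcases hin b (Or.inr rfl) with rfl | h
      · rw [singPrime_comm]
      · exact absurd h hab.symm
  rw [← Ideal.comap_map_eq_self_of_faithfullyFlat (B := AdicCompletion (maximalIdeal R) R) P,
    ← Ideal.comap_map_eq_self_of_faithfullyFlat (B := AdicCompletion (maximalIdeal R) R) P', hJ]

end Summit.ResolutionOfSingularities.ResolutionOfSingularities.Theorems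

end
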